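import Literature.Topology.FourManifolds.Compressible
import Mathlib.Analysis.Convex.Topology
import Mathlib.Topology.MetricSpace.Thickening
import HarnessLib

/-!
# The coarse cell structure of the engulfing engine: cells, skeleta, tracked sets

The bookkeeping sets of the inductive hypotheses `IH(k, m, a)` of the proof of Rushing's
topological engulfing theorem (Rushing 1973, Thm. 4.12.1, p. 202:
`X(k, m, a) = |L| × 0 ∪ (|L| ∩ |L₁|) × [0, 1] ∪ |L| × [0, t_{a-1}] ∪ {σ × [t_{a-1}, t_a] : …}`),
as subsets of `E × ℝ`, in the codimension-three-safe form of the engine (only the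
`r`-skeleton of the cell structure is tracked, cf. Rushing p. 128 and the note at the end of
Case 1 of Fact 2): for a family `F` of vertex sets in `E` (the faces of the triangulation of
`R = Cl(P - Q)`), a subfamily `FQ` (the faces inside `Q`), a partition `t` and the relative
dimension `r`,

* `prismCell τ u u' = conv τ ×ˢ [u, u']`, `prismLevel τ u = conv τ ×ˢ {u}`, `prismBdry`
  (bottom ∪ top ∪ walls), `prismSkel r τ u u'` (the whole cell if `dim τ < r`, else its
  boundary) — all compact;
* `baseSet F FQ t N = |F| × {t 0} ∪ |FQ| × [t 0, t N]` and the **tracked set**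
  `trackSet F FQ t r a k D` before the coarse step `(a, k, D)` (slabs `< a` done, cells of
  slab `a` over faces with `< k` vertices done, and over the faces in `D`);
* the bookkeeping identities of the coarse induction: `trackSet_insert` (one more cell),
  `trackSet_card_succ` (next dimension), `trackSet_slab_succ` (next slab), monotonicity, and
  `top_subset_trackSet` (**at the end the top level `|F| × {t N}` is tracked**), with
  compactness `isCompact_trackSet`.

Everything is proved; the definitions are explicit; no named facts.

## References

* T. B. Rushing, *Topological Embeddings*, Academic Press (1973), proof of Thm. 4.12.1 (the
  sets `X(k, m, a)`, p. 202) and p. 128. [Rushing1973]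
-/

open Set Function Metric

noncomputable section

namespace Literature.Topology.FourManifolds

variable {E : Type*} [NormedAddCommGroup E] [NormedSpace ℝ E]

/-! ### Cells and their skeleta -/

/-- The closed prism cell `conv τ × [u, u']`. [folklore] -/
def prismCell (τ : Finset E) (u u' : ℝ) : Set (E × ℝ) := convexHull ℝ (τ : Set E) ×ˢ Icc u u'

/-- The level `conv τ × {u}`. [folklore] -/
def prismLevel (τ : Finset E) (u : ℝ) : Set (E × ℝ) := convexHull ℝ (τ : Set E) ×ˢ {u}

/-- The tracked boundary of a prism cell: bottom, top and walls.
[cite: Rushing1973, proof of Thm. 4.12.1 (the cells `σ × t_{a-1}`, `∂σ × [t_{a-1}, t_a]`)] -/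
def prismBdry [DecidableEq E] (τ : Finset E) (u u' : ℝ) : Set (E × ℝ) :=
  prismLevel τ u ∪ prismLevel τ u' ∪ ⋃ v ∈ τ, prismCell (τ.erase v) u u'

/-- The tracked part of a prism cell in relative dimension `r`: the whole cell if the base
simplex has at most `r` vertices, its tracked boundary otherwise. [cite: Rushing1973, p. 128] -/
def prismSkel [DecidableEq E] (r : ℕ) (τ : Finset E) (u u' : ℝ) : Set (E × ℝ) :=
  if τ.card ≤ r then prismCell τ u u' else prismBdry τ u u'

/-- Cells are compact. [folklore] -/
theorem isCompact_cellSet (τ : Finset E) (u u' : ℝ) : IsCompact (prismCell τ u u') :=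
  (τ.finite_toSet.isCompact_convexHull (𝕜 := ℝ)).prod isCompact_Icc

/-- Levels are compact. [folklore] -/
theorem isCompact_levelSet (τ : Finset E) (u : ℝ) : IsCompact (prismLevel τ u) :=
  (τ.finite_toSet.isCompact_convexHull (𝕜 := ℝ)).prod isCompact_singleton

/-- Tracked boundaries are compact. [folklore] -/
theorem isCompact_cellBdry [DecidableEq E] (τ : Finset E) (u u' : ℝ) : IsCompact (prismBdry τ u u') :=
  ((isCompact_levelSet τ u).union (isCompact_levelSet τ u')).union
    (τ.finite_toSet.isCompact_biUnion fun _ _ => isCompact_cellSet _ u u')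

/-- Tracked parts are compact. [folklore] -/
theorem isCompact_skelSet [DecidableEq E] (r : ℕ) (τ : Finset E) (u u' : ℝ) :
    IsCompact (prismSkel r τ u u') := by
  unfold prismSkel
  split_ifs
  · exact isCompact_cellSet τ u u'
  · exact isCompact_cellBdry τ u u'

/-- Levels of a cell lie in the cell. [folklore] -/
theorem levelSet_subset_cellSet {τ : Finset E} {u u' s : ℝ} (hs : s ∈ Icc u u') :
    prismLevel τ s ⊆ prismCell τ u u' := fun p hp => ⟨hp.1, by rw [mem_singleton_iff.1 hp.2]; exact hs⟩

/-- The tracked boundary lies in the cell. [folklore] -/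
theorem cellBdry_subset_cellSet [DecidableEq E] {τ : Finset E} {u u' : ℝ} (huu' : u ≤ u') :
    prismBdry τ u u' ⊆ prismCell τ u u' := by
  rintro p ((hp | hp) | hp)
  · exact levelSet_subset_cellSet (left_mem_Icc.2 huu') hp
  · exact levelSet_subset_cellSet (right_mem_Icc.2 huu') hp
  · obtain ⟨v, -, hpv⟩ := mem_iUnion₂.1 hp
    exact ⟨convexHull_mono (by rw [Finset.coe_erase]; exact sdiff_subset) hpv.1, hpv.2⟩

/-- The tracked part lies in the cell. [folklore] -/
theorem skelSet_subset_cellSet [DecidableEq E] (r : ℕ) {τ : Finset E} {u u' : ℝ} (huu' : u ≤ u') :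
    prismSkel r τ u u' ⊆ prismCell τ u u' := by
  unfold prismSkel; split_ifs
  · exact Subset.rfl
  · exact cellBdry_subset_cellSet huu'

/-- The top level is tracked. [folklore] -/
theorem levelSet_top_subset_skelSet [DecidableEq E] (r : ℕ) (τ : Finset E) {u u' : ℝ} (huu' : u ≤ u') :
    prismLevel τ u' ⊆ prismSkel r τ u u' := by
  unfold prismSkel; split_ifs
  · exact levelSet_subset_cellSet (right_mem_Icc.2 huu')
  · exact fun p hp => Or.inl (Or.inr hp)

/-- The bottom level is tracked. [folklore] -/
theorem levelSet_bot_subset_skelSet [DecidableEq E] (r : ℕ) (τ : Finset E) {u u' : ℝ} (huu' : u ≤ u') :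
    prismLevel τ u ⊆ prismSkel r τ u u' := by
  unfold prismSkel; split_ifs
  · exact levelSet_subset_cellSet (left_mem_Icc.2 huu')
  · exact fun p hp => Or.inl (Or.inl hp)

/-- The walls are tracked. [folklore] -/
theorem cellSet_erase_subset_skelSet [DecidableEq E] (r : ℕ) {τ : Finset E} {v : E} (hv : v ∈ τ)
    (u u' : ℝ) : prismCell (τ.erase v) u u' ⊆ prismSkel r τ u u' := by
  unfold prismSkel; split_ifs
  · exact fun p hp => ⟨convexHull_mono (by rw [Finset.coe_erase]; exact sdiff_subset) hp.1, hp.2⟩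
  · exact fun p hp => Or.inr (mem_iUnion₂.2 ⟨v, hv, hp⟩)

/-! ### The tracked sets of the coarse induction -/

section Track

variable [DecidableEq E] (F FQ : Set (Finset E)) (t : ℕ → ℝ) (N r : ℕ)

/-- The base of the tracking: `|F| × {t 0} ∪ |FQ| × [t 0, t N]`.
[cite: Rushing1973, proof of Thm. 4.12.1 (`|L| × 0 ∪ (|L| ∩ |L₁|) × [0, 1]`)] -/
def baseSet : Set (E × ℝ) :=
  facesSpace F ×ˢ {t 0} ∪ facesSpace FQ ×ˢ Icc (t 0) (t N)

/-- **The tracked set before the coarse step `(a, k, D)`**: the base, the tracked parts of all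
cells of the slabs `< a`, of the cells of slab `a` over the faces (outside `FQ`) with fewer
than `k` vertices, and over the faces in `D`. [cite: Rushing1973, proof of Thm. 4.12.1 (`X(k, m, a)`)] -/
def trackSet (a k : ℕ) (D : Set (Finset E)) : Set (E × ℝ) :=
  baseSet F FQ t N ∪
    (⋃ a' ∈ Finset.range a, ⋃ τ ∈ F \ FQ, prismSkel r τ (t a') (t (a' + 1))) ∪
    (⋃ τ ∈ {τ ∈ F \ FQ | τ.card < k}, prismSkel r τ (t a) (t (a + 1))) ∪
    (⋃ τ ∈ D, prismSkel r τ (t a) (t (a + 1)))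

variable {F FQ t N r}

omit [DecidableEq E] in
/-- The base is compact for finite families. [folklore] -/
theorem isCompact_baseSet (hF : F.Finite) (hFQ : FQ.Finite) : IsCompact (baseSet F FQ t N) :=
  ((hF.isCompact_biUnion fun s _ => s.finite_toSet.isCompact_convexHull (𝕜 := ℝ)).prod isCompact_singleton).union
    ((hFQ.isCompact_biUnion fun s _ => s.finite_toSet.isCompact_convexHull (𝕜 := ℝ)).prod isCompact_Icc)

/-- The tracked sets are compact for finite families. [folklore] -/
theorem isCompact_trackSet (hF : F.Finite) (hFQ : FQ.Finite) (a k : ℕ) {D : Set (Finset E)}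
    (hD : D.Finite) : IsCompact (trackSet F FQ t N r a k D) := by
  refine (((isCompact_baseSet hF hFQ).union ?_).union ?_).union ?_
  · exact (Finset.range a).finite_toSet.isCompact_biUnion fun a' _ =>
      (hF.subset sdiff_subset).isCompact_biUnion fun τ _ => isCompact_skelSet r τ _ _
  · exact (hF.subset fun τ hτ => hτ.1.1).isCompact_biUnion fun τ _ => isCompact_skelSet r τ _ _
  · exact hD.isCompact_biUnion fun τ _ => isCompact_skelSet r τ _ _

/-- The base is tracked. [folklore] -/
theorem baseSet_subset_trackSet (a k : ℕ) (D : Set (Finset E)) :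
    baseSet F FQ t N ⊆ trackSet F FQ t N r a k D := fun _ hp => Or.inl (Or.inl (Or.inl hp))

/-- **One more cell**: tracking after the cell over `σ` is done. [folklore] -/
theorem trackSet_insert (a k : ℕ) (D : Set (Finset E)) (σ : Finset E) :
    trackSet F FQ t N r a k (insert σ D) = trackSet F FQ t N r a k D ∪ prismSkel r σ (t a) (t (a + 1)) := by
  simp only [trackSet, biUnion_insert]
  ac_rfl

/-- Monotonicity in the done set. [folklore] -/
theorem trackSet_mono_done (a k : ℕ) {D D' : Set (Finset E)} (h : D ⊆ D') :
    trackSet F FQ t N r a k D ⊆ trackSet F FQ t N r a k D' :=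
  union_subset_union_right _ (biUnion_subset_biUnion_left h)

/-- **Next dimension**: when all faces with `k` vertices are done, the tracked set is that
of the start of dimension `k + 1`. [folklore] -/
theorem trackSet_card_succ (a k : ℕ) :
    trackSet F FQ t N r a k {τ ∈ F \ FQ | τ.card = k} = trackSet F FQ t N r a (k + 1) ∅ := by
  apply Subset.antisymm
  · rintro p (((h | h) | h) | h)
    · exact Or.inl (Or.inl (Or.inl h))
    · exact Or.inl (Or.inl (Or.inr h))
    · obtain ⟨τ, ⟨hτ, hk⟩, hp⟩ := mem_iUnion₂.1 h
      exact Or.inl (Or.inr (mem_iUnion₂.2 ⟨τ, ⟨hτ, Nat.lt_succ_of_lt hk⟩, hp⟩))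
    · obtain ⟨τ, ⟨hτ, hk⟩, hp⟩ := mem_iUnion₂.1 h
      exact Or.inl (Or.inr (mem_iUnion₂.2 ⟨τ, ⟨hτ, by rw [hk]; exact Nat.lt_succ_self k⟩, hp⟩))
  · rintro p (((h | h) | h) | h)
    · exact Or.inl (Or.inl (Or.inl h))
    · exact Or.inl (Or.inl (Or.inr h))
    · obtain ⟨τ, ⟨hτ, hk⟩, hp⟩ := mem_iUnion₂.1 h
      rcases (Nat.lt_succ_iff.1 hk).lt_or_eq with hk | hk
      · exact Or.inl (Or.inr (mem_iUnion₂.2 ⟨τ, ⟨hτ, hk⟩, hp⟩))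
      · exact Or.inr (mem_iUnion₂.2 ⟨τ, ⟨hτ, hk⟩, hp⟩)
    · obtain ⟨τ, hτ, -⟩ := mem_iUnion₂.1 h
      exact absurd hτ (notMem_empty τ)

/-- **Next slab**: when all faces of slab `a` are done (every face has fewer than `K`
vertices), the tracked set is that of the start of slab `a + 1`. [folklore] -/
theorem trackSet_slab_succ (a K : ℕ) (hK : ∀ τ ∈ F, τ.card < K) (hne : ∀ τ ∈ F, τ.Nonempty) :
    trackSet F FQ t N r a K ∅ = trackSet F FQ t N r (a + 1) 1 ∅ := by
  apply Subset.antisymm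
  · rintro p (((h | h) | h) | h)
    · exact Or.inl (Or.inl (Or.inl h))
    · obtain ⟨a', ha', hp⟩ := mem_iUnion₂.1 h
      exact Or.inl (Or.inl (Or.inr (mem_iUnion₂.2 ⟨a', Finset.mem_range.2
        ((Finset.mem_range.1 ha').trans (Nat.lt_succ_self a)), hp⟩)))
    · obtain ⟨τ, ⟨hτ, -⟩, hp⟩ := mem_iUnion₂.1 h
      exact Or.inl (Or.inl (Or.inr (mem_iUnion₂.2 ⟨a, Finset.mem_range.2 (Nat.lt_succ_self a),
        mem_iUnion₂.2 ⟨τ, hτ, hp⟩⟩)))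
    · obtain ⟨τ, hτ, -⟩ := mem_iUnion₂.1 h
      exact absurd hτ (notMem_empty τ)
  · rintro p (((h | h) | h) | h)
    · exact Or.inl (Or.inl (Or.inl h))
    · obtain ⟨a', ha', hp⟩ := mem_iUnion₂.1 h
      rcases (Nat.lt_succ_iff.1 (Finset.mem_range.1 ha')).lt_or_eq with ha' | rfl
      · exact Or.inl (Or.inl (Or.inr (mem_iUnion₂.2 ⟨a', Finset.mem_range.2 ha', hp⟩)))
      · obtain ⟨τ, hτ, hp⟩ := mem_iUnion₂.1 hp
        exact Or.inl (Or.inr (mem_iUnion₂.2 ⟨τ, ⟨hτ, hK τ hτ.1⟩, hp⟩))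
    · obtain ⟨τ, ⟨hτ, hk⟩, -⟩ := mem_iUnion₂.1 h
      exact absurd (Finset.card_pos.2 (hne τ hτ.1)) (not_lt.2 (Nat.lt_one_iff.1 hk).le)
    · obtain ⟨τ, hτ, -⟩ := mem_iUnion₂.1 h
      exact absurd hτ (notMem_empty τ)

/-- **At the end the top level is tracked**: every point of `|F| × {t N}` lies in the tracked
set of the start of slab `N` (`N ≥ 1`). [folklore] -/
theorem top_subset_trackSet {N : ℕ} (hN : 0 < N) (ht : Monotone t) (k : ℕ) (D : Set (Finset E)) :
    facesSpace F ×ˢ {t N} ⊆ trackSet F FQ t N r N k D := by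
  rintro ⟨x, s⟩ ⟨hx, hs⟩
  rw [mem_singleton_iff] at hs; subst hs
  obtain ⟨τ, hτ, hxτ⟩ := mem_facesSpace_iff.1 hx
  by_cases hτQ : τ ∈ FQ
  · -- over `FQ`: in the base
    refine Or.inl (Or.inl (Or.inl (Or.inr ⟨mem_facesSpace_iff.2 ⟨τ, hτQ, hxτ⟩, ?_⟩)))
    exact ⟨ht (Nat.zero_le N), le_rfl⟩
  · -- the top of the cell `(N - 1, τ)`
    obtain ⟨a, rfl⟩ : ∃ a, N = a + 1 := ⟨N - 1, (Nat.succ_pred_eq_of_pos hN).symm⟩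
    refine Or.inl (Or.inl (Or.inr (mem_iUnion₂.2 ⟨a, Finset.mem_range.2 (Nat.lt_succ_self a),
      mem_iUnion₂.2 ⟨τ, ⟨hτ, hτQ⟩, ?_⟩⟩)))
    exact levelSet_top_subset_skelSet r τ (ht (Nat.le_succ a)) ⟨hxτ, rfl⟩

end Track

end Literature.Topology.FourManifolds
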